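import Summits.BirchSwinnertonDyer.BirchSwinnertonDyer.Theorems.RankLeOneBSDpOfUpperSocketCertificate
import Summits.BirchSwinnertonDyer.BirchSwinnertonDyer.Theorems.AdditiveRankOneBSDpRowKernels
import Summits.BirchSwinnertonDyer.BirchSwinnertonDyer.Theorems.AdditivePotSupersingularControlOfFacts
import HarnessLib

/-!
# `BSD_p` on EVERY potentially supersingular additive row of analytic rank `≤ 1` — rank ZERO included, at its own
# Heegner datum — from ONE ♭-inclusion at the curve, exact control DISCHARGED modulo seven published facts,
# Hsieh + LZZ, GZK, Kolyvagin, and FINITE certificates: the rank-zero wild leaf (`WildRankZeroTwistAtThree`,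
# stmt-BirchSwinnertonDyer-20387 = `WAllExclAddWildRankZero`) joins the one-inclusion accounting in certificate
# currency (cell `bsd-wall`, D-0131 (3) M-UTD, seat `bsd-wall-utd-p3` gen 2)

Composition of three landed pieces: kmc g20's ♭ socket producer
`UniversalToricDescentWaldspurgerFlat.indexUpperBoundLeAt_of_flatInclGe_of_control` (ANY odd additive `p`, NO
rank or image binder: ♭-inclusion `(Q) ⊆ Ch_Λ(X_(∅,0) at 𝔭′)·𝓞_{ℂ_p}⟦T⟧` at every frame of one Heegner field +
exact control at every degree-one `𝔭` ⟹ `Upper.IndexUpperBoundLeAt W p K P (v_p c)`), kmc g20's control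
discharge `additiveControl_heegner_potSS_of_facts_of_serre1967` (Heegner-datum form, `ClassO5 W p ∨ ClassO6 W p`,
`ρ̄_{E,p}` irreducible, NO rank binder; modulo Poitou–Tate ×2, local Euler–Poincaré, `cd_p ≤ 2`, Brink Thm 2 /
Cor 1, Serre 1967 §5 Prop. 8), and gen 2's socket-currency certificates
(`RankLeOneBSDpOfUpperSocketCertificate`, `r_an(E) ≤ 1`). RESULT:

* §1 **`bsdp_potSS_of_flatInclGe_of_facts_of_index_le_of_shaAnUnit`** — for `W/ℚ` globally minimal on
  `ClassO5 W p ∨ ClassO6 W p` (every potentially supersingular additive row: tame `(t′) ∪ (G)∧ss` at any odd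
  `p`, wild O6 at `p = 3`) with `ρ̄_{E,p}` irreducible and `r_an(E) ≤ 1` — so the RANK-ZERO rows too — and ONE
  Heegner datum `(N = N(E), K, Dt, H, ι, P)` with `d_K < −4` and `P` of infinite order (for `r_an(E) = 0` this is a
  field with `r_an(E^{d_K}) = 1`; for `r_an(E) = 1` one with `L(E^{d_K},1) ≠ 0`): the ♭-inclusion at every frame
  of `K` (displayed) + the seven facts + Hsieh 2014 Thm A + LZZ 2018 + GZK + Kolyvagin (named) + the certificates
  `ord_p [E(K):ℤP] ≤ ord_p ∏_ℓ c_ℓ(E) + v_p(c)` and `#Ш_an(E)` a `p`-adic unit ⟹ `BSDp W p`. NO twist `BSD_p`, NO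
  Kato descent, NO lower socket, NO `R₀`.
* §2 `bsdp_potSS_of_flatInclGe_of_facts_of_excess_certificates` / `partner_…` — the excess shapes (index excess
  `e`, `p`-descent lower certificates `a + b = 2e`) for `E` (rank one, `L(E^{d_K},1) ≠ 0`) and its rank-ZERO twist.

PARTITION reading (census READ, not re-derived): block A at `3` = O6 wild r1 onto 3 894 + O5/O6 other images and
r0 rows (K9's `WildRankZero` residual 19199/…, leaf #6 = `WAllExclAddWildRankZero`; tame `WAllExclAddTprimeAtThree
RankOne` 3 533, `WAllExclAddGssAtThree` 1 060 — pss3 g6's TQS target): in ♭-certificate currency EVERY irreducible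
row of analytic rank ≤ 1 is ONE ♭-inclusion at the curve + seven facts + Hsieh/LZZ/GZK/Kolyvagin + finite
certificates. For the UTD steward: dropping the binder `W.analyticRank = 1 →` (and `ρ̄₃` onto ↦ irreducible) from
a ♭-typed 20395 would let ONE crux carry leaf #6's habitat in this currency. Classes closed: 0; «beyond-print
theorem»: NO (the inclusion is research-grade at every additive prime). HONEST FRAMING: CONDITIONAL on every
displayed hypothesis; per datum; books nothing by itself; whether computed certificates are admissible per-class
inputs is the referee desks' call; BSD is proved for no curve by this file. No definition, no named fact, no `sorry`.
References: [JetchevSkinnerWan2017] §7.4.1, Thm. 3.3.1; [Castella2018] Thm 2.3, §5; [Hsieh2014] Thm A;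
[LiuZhangZhang2018] Thm 1.5.1/1.5.3; [MilneADT2006] I 2.8, 4.10; [Brink2007] Thm 2, Cor 1;
[Serre1967GroupesPDivisibles] §5 Prop. 8; [Kolyvagin1990] Thm A; [GrossLMS1991] §2; [Miller2011LMS] Def. 1.1.
-/

noncomputable section

open scoped Classical

set_option linter.dupNamespace false
set_option autoImplicit false

namespace Summit.BirchSwinnertonDyer.BirchSwinnertonDyer.Theorems.WildThreeInclusionKernel

open WeierstrassCurve NumberField IsDedekindDomain Field
  Literature.NumberTheory.EllipticCurves
  Literature.NumberTheory.EllipticCurves.ModularForms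
  Literature.NumberTheory.EllipticCurves.Rank1Residual
  Literature.NumberTheory.EllipticCurves.Rank1Residual.Typed
  Literature.NumberTheory.EllipticCurves.KrizLi2019
  Literature.NumberTheory.EllipticCurves.GreenbergSelmer
  Literature.NumberTheory.GaloisRepresentations
  Literature.NumberTheory.GaloisCohomology
  Summit.BirchSwinnertonDyer.Rank1Residual
  Summit.BirchSwinnertonDyer.Rank1Residual.Additive
  Summit.BirchSwinnertonDyer.Rank1Residual.X11b
  Summit.BirchSwinnertonDyer.Rank1Residual.X11b.AcSelmer
  Summit.BirchSwinnertonDyer.Rank1Residual.X11b.Halves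
  UniversalToricDescentWaldspurgerFlat AdditivePotSupersingularControl

variable {p : ℕ} [Fact p.Prime] {W : WeierstrassCurve ℚ} [W.IsElliptic] [W.IsGloballyMinimal]
  {N : ℕ} [NeZero N] {K : Type} [Field K] [NumberField K]

/-! ### §1 Excess `0`: `BSD_p(E)` on every potentially supersingular row of analytic rank `≤ 1` -/

/-- **`BSD_p(E)` at a potentially supersingular additive prime, analytic rank `≤ 1` (rank ZERO included), from ONE
♭-inclusion + seven published facts + certificates.** Data: `W` globally minimal on `ClassO5 W p ∨ ClassO6 W p`,
`ρ̄_{E,p}` irreducible, `r_an(E) ≤ 1`; a Heegner datum `(N = N(E), K, Dt, H, ι, P)` with `K` imaginary quadratic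
Heegner for `N`, `d_K < −4`, `P` the Heegner point of infinite order, Kolyvagin for the datum; the ♭-inclusion
`(Q) ⊆ Ch_Λ(X_(∅,0) at 𝔭′)·𝓞_{ℂ_p}⟦T⟧` at every anticyclotomic frame of `K` (displayed); named facts:
Poitou–Tate ×2, local Euler–Poincaré, `cd ≤ 2`, Brink Thm 2 / Cor 1, Serre 1967 (control), Hsieh 2014 Thm A, LZZ
2018 (frame + value), GZK; certificates `ord_p [E(K):ℤP] ≤ ord_p ∏_ℓ c_ℓ(E) + v_p(c(Dt))` and `#Ш_an(E) = q`,
`ord_p q = 0`. Then `BSDp W p`. CONDITIONAL; per datum; books nothing by itself.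
[cite: JetchevSkinnerWan2017, §7.4.1 and Thm. 3.3.1 (arXiv:1512.06894 pp. 11, 30)] [cite: Hsieh2014, Thm. A p. 712 (Doc. Math. 19)]
[cite: LiuZhangZhang2018, Thm 1.5.1 and Thm 1.5.3 (Duke Math. J. 167 pp. 748–749)] [cite: Serre1967GroupesPDivisibles, §5 Prop. 8]
[cite: Miller2011LMS, §1 and Def. 1.1] -/
theorem bsdp_potSS_of_flatInclGe_of_facts_of_index_le_of_shaAnUnit
    (hPT : ∀ (K : Type) [Field K] [NumberField K], poitouTate_selmerStructure_duality K)
    (hPT2 : ∀ (K : Type) [Field K] [NumberField K], poitouTate_sha_tateDual K)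
    (hEP : ∀ (K : Type) [Field K] [NumberField K] (v : HeightOneSpectrum (𝓞 K)),
      localEulerPoincareCharacteristic (v.adicCompletion K))
    (hcd : fieldCdLE_two_of_numberField)
    (hBr : ∀ (K : Type) [Field K] [NumberField K] (p : ℕ) [Fact p.Prime],
      ZpExtension.decomp_not_le_kerSubgroup_of_isAnticyclotomic K p)
    (hBr2 : ∀ (K : Type) [Field K] [NumberField K] (p : ℕ) [Fact p.Prime],
      ZpExtension.decomp_not_le_kerSubgroup_above_of_isAnticyclotomic K p)
    (hS : Serre1967.noStableDivisibleLine_of_potentiallySupersingular)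
    (hA : Hsieh2014.thmA_exists_isHsiehLFunction_unrPeriod_anyLevel)
    (hL : LiuZhangZhang2018.thm151_thm153_modularCurve_heegnerVector_additive)
    (hGZK : rank_eq_analyticRank_of_analyticRank_le_one)
    (hcls : ClassO5 W p ∨ ClassO6 W p) (hirr : W.HasIrreducibleModPGaloisRep p) (hr : W.analyticRank ≤ 1)
    (Dt : ModularParametrizationData W N) (H : HeegnerDatum N (NumberField.discr K)) (ι : K →+* ℂ)
    (P : (W.baseChange K).toAffine.Point) (hN : W.conductorNorm ℤ = N) (hK : IsImaginaryQuadratic K)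
    (hHN : SatisfiesHeegnerHypothesis N K) (hd4 : NumberField.discr K < -4)
    (hP : WeierstrassCurve.Affine.Point.map ι.toRatAlgHom P = heegnerPointComplex Dt H) (hnt : ¬ IsOfFinAddOrder P)
    (hKo : Literature.NumberTheory.EllipticCurves.kolyvagin N W K)
    (hIncl : ∀ (κ : ZpExtension K p), κ.IsAnticyclotomic → ∀ (γ : Field.absoluteGaloisGroup K) [Fact (κ.IsTopGenerator γ)]
        (𝔭 : HeightOneSpectrum (𝓞 K)), ((p : ℕ) : 𝓞 K) ∈ 𝔭.asIdeal → 𝔭.asIdeal.ramificationIdx (𝓞 ℚ) = 1 →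
        𝔭.asIdeal.inertiaDeg (𝓞 ℚ) = 1 → ∀ (𝔭' : HeightOneSpectrum (𝓞 K)), ((p : ℕ) : 𝓞 K) ∈ 𝔭'.asIdeal → 𝔭' ≠ 𝔭 →
        ∀ (ι' : PadicAlgCl p ≃+* ℂ), SchneiderFree.BranchInducesPrime p ι' 𝔭 →
        ∀ (ΩK : ℂ) (Ωp : ℂ_[p]) (Q : PowerSeries (PadicComplexInt p)), ΩK ≠ 0 → Ωp ≠ 0 →
          R1.IsBDPLFunctionInt p ι' 𝔭 κ γ Dt.f ΩK Ωp Q →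
          Ideal.span {Q} ≤ (XAc.charIdeal (W.baseChange K) p κ 𝔭' ∅ γ).map (PowerSeries.map (R1.toCpInt p)))
    (hIdx : padicValNat p (AddSubgroup.zmultiples P).index ≤ padicValNat p W.tamagawaProduct + padicValNat p Dt.c.natAbs)
    {q : ℚ} (hq : shaAn W = (q : ℂ)) (hv : padicValRat p q = 0) : BSDp W p := by
  have hp2 : p ≠ 2 := hcls.elim (fun h ↦ h.1) (fun h ↦ h.1)
  have hadd : Addv W p := hcls.elim (fun h ↦ h.2.1) (fun h ↦ h.2.1)
  -- exact control at every anticyclotomic frame of `K`, from the seven facts (kmc g20)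
  have hCtl : ∀ (κ : ZpExtension K p), κ.IsAnticyclotomic → ∀ (γ : Field.absoluteGaloisGroup K)
      [Fact (κ.IsTopGenerator γ)] (𝔭 : HeightOneSpectrum (𝓞 K)) (h𝔭 : ((p : ℕ) : 𝓞 K) ∈ 𝔭.asIdeal)
      (he : 𝔭.asIdeal.ramificationIdx (𝓞 ℚ) = 1) (hf : 𝔭.asIdeal.inertiaDeg (𝓞 ℚ) = 1),
      SchneiderFree.AdditiveControlOnTreeAt p κ 𝔭 γ (embAt K p 𝔭 h𝔭 he hf) P :=
    fun κ hκ γ _ 𝔭 h𝔭 he hf ↦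
      additiveControl_heegner_potSS_of_facts_of_serre1967 hPT hPT2 hEP hcd hBr hBr2 hS p W N K Dt H ι P hcls
        hirr hN hK hHN hP hnt hKo κ hκ γ 𝔭 h𝔭 he hf
  exact SchneiderFree.Exact.bsdp_of_upper_of_index_le_of_shaAnUnit hGZK W hr K hK p hp2
    (indexUpperBoundLeAt_of_flatInclGe_of_control hp2 hA hL Dt H ι P hadd hN hK hHN hd4 hP hnt hKo hIncl hCtl)
    hIdx (hKo hK hHN ⟨Dt, H, ι, hP⟩ hnt).2 hq hv

/-! ### §2 Excess `e`: the rank-one curve and its rank-zero twist from the ♭-inclusion + descent certificates -/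

/-- **`BSD_p(E)` on the excess shapes at a potentially supersingular additive prime** (rank one: `L(E^{d_K},1) ≠ 0`,
`Wd` a `ℚ`-model of the twist): the ♭-inclusion + seven facts + Hsieh/LZZ/GZK/Kolyvagin + index excess `e` + lower
certificates `a ≤ ord_p #Ш(E)`, `b ≤ ord_p #Ш(Wd)`, `a + b = 2e` + `#Ш_an(E) = q`, `ord_p q = a` ⟹ `BSDp W p`.
CONDITIONAL; per datum. [cite: JetchevSkinnerWan2017, §7.4.1 and Thm. 3.3.1 (arXiv:1512.06894 pp. 11, 30)]
[cite: Serre1967GroupesPDivisibles, §5 Prop. 8] [cite: Miller2011LMS, Def. 1.1] [cite: DokchitserDokchitserAnnals2010, Lemma 4.14] -/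
theorem bsdp_potSS_of_flatInclGe_of_facts_of_excess_certificates
    (hPT : ∀ (K : Type) [Field K] [NumberField K], poitouTate_selmerStructure_duality K)
    (hPT2 : ∀ (K : Type) [Field K] [NumberField K], poitouTate_sha_tateDual K)
    (hEP : ∀ (K : Type) [Field K] [NumberField K] (v : HeightOneSpectrum (𝓞 K)),
      localEulerPoincareCharacteristic (v.adicCompletion K))
    (hcd : fieldCdLE_two_of_numberField)
    (hBr : ∀ (K : Type) [Field K] [NumberField K] (p : ℕ) [Fact p.Prime],
      ZpExtension.decomp_not_le_kerSubgroup_of_isAnticyclotomic K p)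
    (hBr2 : ∀ (K : Type) [Field K] [NumberField K] (p : ℕ) [Fact p.Prime],
      ZpExtension.decomp_not_le_kerSubgroup_above_of_isAnticyclotomic K p)
    (hS : Serre1967.noStableDivisibleLine_of_potentiallySupersingular)
    (hA : Hsieh2014.thmA_exists_isHsiehLFunction_unrPeriod_anyLevel)
    (hL : LiuZhangZhang2018.thm151_thm153_modularCurve_heegnerVector_additive)
    (hGZK : rank_eq_analyticRank_of_analyticRank_le_one)
    (hcls : ClassO5 W p ∨ ClassO6 W p) (hirr : W.HasIrreducibleModPGaloisRep p) (hr : W.analyticRank ≤ 1)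
    (Dt : ModularParametrizationData W N) (H : HeegnerDatum N (NumberField.discr K)) (ι : K →+* ℂ)
    (P : (W.baseChange K).toAffine.Point) (hN : W.conductorNorm ℤ = N) (hK : IsImaginaryQuadratic K)
    (hHN : SatisfiesHeegnerHypothesis N K) (hd4 : NumberField.discr K < -4)
    (hP : WeierstrassCurve.Affine.Point.map ι.toRatAlgHom P = heegnerPointComplex Dt H) (hnt : ¬ IsOfFinAddOrder P)
    (hKo : Literature.NumberTheory.EllipticCurves.kolyvagin N W K)
    (hIncl : ∀ (κ : ZpExtension K p), κ.IsAnticyclotomic → ∀ (γ : Field.absoluteGaloisGroup K) [Fact (κ.IsTopGenerator γ)]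
        (𝔭 : HeightOneSpectrum (𝓞 K)), ((p : ℕ) : 𝓞 K) ∈ 𝔭.asIdeal → 𝔭.asIdeal.ramificationIdx (𝓞 ℚ) = 1 →
        𝔭.asIdeal.inertiaDeg (𝓞 ℚ) = 1 → ∀ (𝔭' : HeightOneSpectrum (𝓞 K)), ((p : ℕ) : 𝓞 K) ∈ 𝔭'.asIdeal → 𝔭' ≠ 𝔭 →
        ∀ (ι' : PadicAlgCl p ≃+* ℂ), SchneiderFree.BranchInducesPrime p ι' 𝔭 →
        ∀ (ΩK : ℂ) (Ωp : ℂ_[p]) (Q : PowerSeries (PadicComplexInt p)), ΩK ≠ 0 → Ωp ≠ 0 →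
          R1.IsBDPLFunctionInt p ι' 𝔭 κ γ Dt.f ΩK Ωp Q →
          Ideal.span {Q} ≤ (XAc.charIdeal (W.baseChange K) p κ 𝔭' ∅ γ).map (PowerSeries.map (R1.toCpInt p)))
    (Wd : WeierstrassCurve ℚ) [Wd.IsElliptic]
    (hLd : (W.quadraticTwist (NumberField.discr K : ℚ)).entireLFunction 1 ≠ 0)
    (hCd : ∃ C : VariableChange ℚ, C • W.quadraticTwist (NumberField.discr K : ℚ) = Wd)
    {e a b : ℕ} (hIdx : padicValNat p (AddSubgroup.zmultiples P).index ≤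
      padicValNat p W.tamagawaProduct + padicValNat p Dt.c.natAbs + e)
    (ha : a ≤ padicValNat p W.shaOrder) (hb : b ≤ padicValNat p Wd.shaOrder) (hab : a + b = 2 * e)
    {q : ℚ} (hq : shaAn W = (q : ℂ)) (hv : padicValRat p q = a) : BSDp W p := by
  have hp2 : p ≠ 2 := hcls.elim (fun h ↦ h.1) (fun h ↦ h.1)
  have hadd : Addv W p := hcls.elim (fun h ↦ h.2.1) (fun h ↦ h.2.1)
  have hCtl : ∀ (κ : ZpExtension K p), κ.IsAnticyclotomic → ∀ (γ : Field.absoluteGaloisGroup K)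
      [Fact (κ.IsTopGenerator γ)] (𝔭 : HeightOneSpectrum (𝓞 K)) (h𝔭 : ((p : ℕ) : 𝓞 K) ∈ 𝔭.asIdeal)
      (he : 𝔭.asIdeal.ramificationIdx (𝓞 ℚ) = 1) (hf : 𝔭.asIdeal.inertiaDeg (𝓞 ℚ) = 1),
      SchneiderFree.AdditiveControlOnTreeAt p κ 𝔭 γ (embAt K p 𝔭 h𝔭 he hf) P :=
    fun κ hκ γ _ 𝔭 h𝔭 he hf ↦
      additiveControl_heegner_potSS_of_facts_of_serre1967 hPT hPT2 hEP hcd hBr hBr2 hS p W N K Dt H ι P hcls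
        hirr hN hK hHN hP hnt hKo κ hκ γ 𝔭 h𝔭 he hf
  exact SchneiderFree.Exact.bsdp_of_upper_of_excess_certificates hGZK W hr K hK p hp2 Wd hLd hCd
    (hKo hK hHN ⟨Dt, H, ι, hP⟩ hnt).2
    (indexUpperBoundLeAt_of_flatInclGe_of_control hp2 hA hL Dt H ι P hadd hN hK hHN hd4 hP hnt hKo hIncl hCtl)
    hIdx ha hb hab hq hv

/-- **`BSD_p(E^{d_K})` — the rank-ZERO twist (globally minimal model `Wd`) of a rank-one potentially supersingular row
— from the ♭-inclusion for `E` + seven facts + excess certificates**, analytic certificate on the twist's side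
(`#Ш_an(Wd) = qd`, `ord_p qd = b`). CONDITIONAL; per datum. [cite: JetchevSkinnerWan2017, §7.4.1 (arXiv:1512.06894 p. 30)]
[cite: Serre1967GroupesPDivisibles, §5 Prop. 8] [cite: Miller2011LMS, Def. 1.1] [cite: DokchitserDokchitserAnnals2010, Lemma 4.14] -/
theorem partner_bsdp_potSS_of_flatInclGe_of_facts_of_excess_certificates
    (hPT : ∀ (K : Type) [Field K] [NumberField K], poitouTate_selmerStructure_duality K)
    (hPT2 : ∀ (K : Type) [Field K] [NumberField K], poitouTate_sha_tateDual K)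
    (hEP : ∀ (K : Type) [Field K] [NumberField K] (v : HeightOneSpectrum (𝓞 K)),
      localEulerPoincareCharacteristic (v.adicCompletion K))
    (hcd : fieldCdLE_two_of_numberField)
    (hBr : ∀ (K : Type) [Field K] [NumberField K] (p : ℕ) [Fact p.Prime],
      ZpExtension.decomp_not_le_kerSubgroup_of_isAnticyclotomic K p)
    (hBr2 : ∀ (K : Type) [Field K] [NumberField K] (p : ℕ) [Fact p.Prime],
      ZpExtension.decomp_not_le_kerSubgroup_above_of_isAnticyclotomic K p)
    (hS : Serre1967.noStableDivisibleLine_of_potentiallySupersingular)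
    (hA : Hsieh2014.thmA_exists_isHsiehLFunction_unrPeriod_anyLevel)
    (hL : LiuZhangZhang2018.thm151_thm153_modularCurve_heegnerVector_additive)
    (hGZK : rank_eq_analyticRank_of_analyticRank_le_one)
    (hcls : ClassO5 W p ∨ ClassO6 W p) (hirr : W.HasIrreducibleModPGaloisRep p) (hr : W.analyticRank ≤ 1)
    (Dt : ModularParametrizationData W N) (H : HeegnerDatum N (NumberField.discr K)) (ι : K →+* ℂ)
    (P : (W.baseChange K).toAffine.Point) (hN : W.conductorNorm ℤ = N) (hK : IsImaginaryQuadratic K)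
    (hHN : SatisfiesHeegnerHypothesis N K) (hd4 : NumberField.discr K < -4)
    (hP : WeierstrassCurve.Affine.Point.map ι.toRatAlgHom P = heegnerPointComplex Dt H) (hnt : ¬ IsOfFinAddOrder P)
    (hKo : Literature.NumberTheory.EllipticCurves.kolyvagin N W K)
    (hIncl : ∀ (κ : ZpExtension K p), κ.IsAnticyclotomic → ∀ (γ : Field.absoluteGaloisGroup K) [Fact (κ.IsTopGenerator γ)]
        (𝔭 : HeightOneSpectrum (𝓞 K)), ((p : ℕ) : 𝓞 K) ∈ 𝔭.asIdeal → 𝔭.asIdeal.ramificationIdx (𝓞 ℚ) = 1 →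
        𝔭.asIdeal.inertiaDeg (𝓞 ℚ) = 1 → ∀ (𝔭' : HeightOneSpectrum (𝓞 K)), ((p : ℕ) : 𝓞 K) ∈ 𝔭'.asIdeal → 𝔭' ≠ 𝔭 →
        ∀ (ι' : PadicAlgCl p ≃+* ℂ), SchneiderFree.BranchInducesPrime p ι' 𝔭 →
        ∀ (ΩK : ℂ) (Ωp : ℂ_[p]) (Q : PowerSeries (PadicComplexInt p)), ΩK ≠ 0 → Ωp ≠ 0 →
          R1.IsBDPLFunctionInt p ι' 𝔭 κ γ Dt.f ΩK Ωp Q →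
          Ideal.span {Q} ≤ (XAc.charIdeal (W.baseChange K) p κ 𝔭' ∅ γ).map (PowerSeries.map (R1.toCpInt p)))
    (Wd : WeierstrassCurve ℚ) [Wd.IsElliptic] [Wd.IsGloballyMinimal]
    (hLd : (W.quadraticTwist (NumberField.discr K : ℚ)).entireLFunction 1 ≠ 0)
    (hCd : ∃ C : VariableChange ℚ, C • W.quadraticTwist (NumberField.discr K : ℚ) = Wd)
    {e a b : ℕ} (hIdx : padicValNat p (AddSubgroup.zmultiples P).index ≤
      padicValNat p W.tamagawaProduct + padicValNat p Dt.c.natAbs + e)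
    (ha : a ≤ padicValNat p W.shaOrder) (hb : b ≤ padicValNat p Wd.shaOrder) (hab : a + b = 2 * e)
    {qd : ℚ} (hqd : shaAn Wd = (qd : ℂ)) (hvd : padicValRat p qd = b) : BSDp Wd p := by
  have hp2 : p ≠ 2 := hcls.elim (fun h ↦ h.1) (fun h ↦ h.1)
  have hadd : Addv W p := hcls.elim (fun h ↦ h.2.1) (fun h ↦ h.2.1)
  have hCtl : ∀ (κ : ZpExtension K p), κ.IsAnticyclotomic → ∀ (γ : Field.absoluteGaloisGroup K)
      [Fact (κ.IsTopGenerator γ)] (𝔭 : HeightOneSpectrum (𝓞 K)) (h𝔭 : ((p : ℕ) : 𝓞 K) ∈ 𝔭.asIdeal)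
      (he : 𝔭.asIdeal.ramificationIdx (𝓞 ℚ) = 1) (hf : 𝔭.asIdeal.inertiaDeg (𝓞 ℚ) = 1),
      SchneiderFree.AdditiveControlOnTreeAt p κ 𝔭 γ (embAt K p 𝔭 h𝔭 he hf) P :=
    fun κ hκ γ _ 𝔭 h𝔭 he hf ↦
      additiveControl_heegner_potSS_of_facts_of_serre1967 hPT hPT2 hEP hcd hBr hBr2 hS p W N K Dt H ι P hcls
        hirr hN hK hHN hP hnt hKo κ hκ γ 𝔭 h𝔭 he hf
  exact SchneiderFree.Exact.partner_bsdp_of_upper_of_excess_certificates hGZK W hr K hK p hp2 Wd hLd hCd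
    (hKo hK hHN ⟨Dt, H, ι, hP⟩ hnt).2
    (indexUpperBoundLeAt_of_flatInclGe_of_control hp2 hA hL Dt H ι P hadd hN hK hHN hd4 hP hnt hKo hIncl hCtl)
    hIdx ha hb hab hqd hvd

end Summit.BirchSwinnertonDyer.BirchSwinnertonDyer.Theorems.WildThreeInclusionKernel

end
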